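import Summits.BirchSwinnertonDyer.BirchSwinnertonDyer.Theorems.SignedLowerHalvesSmallImageLowerHalfBothSignsRttCharRoadE1TopPackaging
import HarnessLib

/-!
# Route `SignedLowerHalves`, crux L `SmallImageLowerHalfBothSigns` (stmt-BirchSwinnertonDyer-23599), line `rtt_w3` v12 — glue brick L3-top, `condAbove` FORM:
# the variant of `resOfLe_mem_acSignedSelmer_of_layer` (p766929) whose hypothesis at the places above `p` is stated directly at infinite level as
# `res_∞ η ∈ AcSigned.condAbove W p κ v (.sgn ε)` — the exact OUTPUT shape of -w3 g17's one-theorem `p`-part of the glue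
# (`resOfLe_corH1_mem_condAbove_sgn`, `…RttCharRoadE1LocalAtPGlue`, p767… ) — so that the two landed halves of block DESC compose without re-deriving
# the layer-`n` Kobayashi condition for every conjugate.

LEAD `cruxlead-stmt-BirchSwinnertonDyer-23599` g7 (cell `bsd-ssimc`; `--supports stmt-BirchSwinnertonDyer-23599 --as helper`). THEOREMS ONLY (no definition, no named fact,
no instance, no `sorry`). BSD / crux L / INJ_top are NOT proved here.

WHAT: ★ `resOfLe_mem_acSignedSelmer_of_layer_of_condAbove`, `resOfLe_mem_acSignedSelmer_pTorsion_of_layer_of_condAbove`.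

References: [BDKim2009] pp. 182, 185; [GreenbergVatsal2000] §2 p. 17; [Kobayashi2003] Def. 1.1.
-/

set_option autoImplicit false
set_option linter.dupNamespace false -- D-0017: single-problem summit, the namespace repeats the problem name by design
noncomputable section

open scoped Classical

namespace Summit.BirchSwinnertonDyer.BirchSwinnertonDyer.Theorems.SmallImageCharSignedSelmer

open NumberField IsDedekindDomain Field
open Literature.NumberTheory.EllipticCurves Literature.NumberTheory.EllipticCurves.GreenbergSelmer
  Literature.NumberTheory.EllipticCurves.GreenbergVatsal2000 Literature.NumberTheory.GaloisRepresentations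
  Literature.NumberTheory.EllipticCurves.AcSigned WeierstrassCurve

variable {W : WeierstrassCurve ℚ} {p : ℕ} [Fact p.Prime] (κ : ZpExtension ℚ p)

/-- ★ **Layer `n` ⟹ Kim's group at infinite level, `condAbove` form.** `κ` cyclotomic, `p` odd, any `S₀`; `η ∈ H¹(ℚ_n, W[p^∞])` with `p • η = 0`, unramified
outside `S₀ ∪ {p}` (all conjugates), and such that `res_{ℚ_∞} η` satisfies the signed condition `AcSigned.condAbove W p κ v (.sgn ε)` at every `v ∣ p`; then
`res_{ℚ_∞} η ∈ AcSigned.selmer W p κ S₀ (fun _ ↦ .sgn ε)`. [cite: BDKim2009, pp. 182, 185] [cite: GreenbergVatsal2000, §2 p. 17] -/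
theorem resOfLe_mem_acSignedSelmer_of_layer_of_condAbove (hp : p ≠ 2) (hκ : κ.IsCyclotomic) (S₀ : Set (HeightOneSpectrum (𝓞 ℚ))) (ε : ℤˣ) {n : ℕ}
    (η : W.subgroupH1 p (κ.layerSubgroup n)) (hηp : p • η = 0)
    (hunr : η ∈ unramifiedOutside (κ.layerSubgroup n) (W.geomPrimaryTorsion p) p S₀)
    (hsgn : ∀ v : HeightOneSpectrum (𝓞 ℚ), ((p : ℕ) : 𝓞 ℚ) ∈ v.asIdeal →
      W.resOfLe p (κ.kerSubgroup_le_layerSubgroup n) η ∈ condAbove W p κ v (PCond.sgn ε)) :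
    W.resOfLe p (κ.kerSubgroup_le_layerSubgroup n) η ∈ selmer W p κ S₀ (fun _ ↦ PCond.sgn ε) := by
  rw [mem_selmer_iff]
  refine ⟨?_, fun v hpv ↦ hsgn v hpv⟩
  rw [mem_awayConditions_iff]
  refine ⟨fun v hpv hvS σ ↦ ?_, fun w σ ↦ ?_⟩
  · rw [conjH1_resOfLe_eq]
    have hunr' : W.conjH1 p (κ.layerSubgroup n) σ η ∈ unramifiedKer (κ.layerSubgroup n) (W.geomPrimaryTorsion p) v :=
      (mem_unramifiedOutside_iff _).1 hunr v hvS hpv σ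
    exact unramifiedKer_kerSubgroup_le_awayKer_of_isCyclotomic κ hκ hpv
      (resOfLe_mem_unramifiedKer (M := W.geomPrimaryTorsion p) (κ.kerSubgroup_le_layerSubgroup n) v hunr')
  · rw [conjH1_resOfLe_eq]
    refine SignedKatoOffTwo.FineSandwich.mem_infKer_of_odd_nsmul_eq_zero (H := κ.kerSubgroup) (M := W.geomPrimaryTorsion p) (w := w)
      (hn := (Fact.out : p.Prime).odd_of_ne_two hp) (c := _) ?_
    rw [← map_nsmul, ← map_nsmul, hηp, map_zero, map_zero]

/-- The same as an element of the INJ_top target `{x : AcSigned.selmer W p κ S₀ (fun _ ↦ .sgn ε) | p • x = 0}`. [cite: BDKim2009, pp. 182, 185] -/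
theorem resOfLe_mem_acSignedSelmer_pTorsion_of_layer_of_condAbove (hp : p ≠ 2) (hκ : κ.IsCyclotomic) (S₀ : Set (HeightOneSpectrum (𝓞 ℚ))) (ε : ℤˣ)
    {n : ℕ} (η : W.subgroupH1 p (κ.layerSubgroup n)) (hηp : p • η = 0)
    (hunr : η ∈ unramifiedOutside (κ.layerSubgroup n) (W.geomPrimaryTorsion p) p S₀)
    (hsgn : ∀ v : HeightOneSpectrum (𝓞 ℚ), ((p : ℕ) : 𝓞 ℚ) ∈ v.asIdeal →
      W.resOfLe p (κ.kerSubgroup_le_layerSubgroup n) η ∈ condAbove W p κ v (PCond.sgn ε)) :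
    (⟨W.resOfLe p (κ.kerSubgroup_le_layerSubgroup n) η,
        resOfLe_mem_acSignedSelmer_of_layer_of_condAbove κ hp hκ S₀ ε η hηp hunr hsgn⟩ : selmer W p κ S₀ (fun _ ↦ PCond.sgn ε)) ∈
      {x : selmer W p κ S₀ (fun _ ↦ PCond.sgn ε) | p • x = 0} := by
  rw [Set.mem_setOf_eq]
  exact Subtype.ext (by rw [AddSubgroupClass.coe_nsmul, ← map_nsmul, hηp, map_zero]; rfl)

end Summit.BirchSwinnertonDyer.BirchSwinnertonDyer.Theorems.SmallImageCharSignedSelmer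

end
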